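import Literature.NumberTheory.LFunctions.HardyZSignParity
import Literature.NumberTheory.LFunctions.Brent1979Reduction
import HarnessLib

/-!
# SigmaL / BC5 rung W0 — the windowed Brent criterion (RH-free)

Route `RiemannHypothesis/HardyZLehmerSplit`, item `SigmaL` (stmt-RiemannHypothesis-24253), tribunal
seat `rh-trib-w-sigmaL-1`. Re-filed sorry-free from the crux workfile `Cruxes/SigmaL/Lines/rung.lean` §8
(commit 08d91a8805b9) for use by the certificate `Theorems/SigmaLW0Cert.lean`. NOTHING HERE PROVES OR
ASSUMES RH; nothing here bears on the truth of RH.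

* (`Literature.NumberTheory.LFunctions.exists_finset_zeros_of_hardyZ_sign_changes`, Brent1979Reduction —
  `m` strict sign changes of `Z` along a grid locate `m` critical zeros inside the grid, IVT — is reused);
* `onLine_of_located_zeros` — if `Z ⊂ (a, b]` are ordinates of critical zeros and `N(b) ≤ N(a) + |Z|`,
  every zero of `ζ` with ordinate in `(a, b]` has real part `½` (the off-line count `N − N₀` is monotone);
* `onLine_of_window_certificate` — grid + sign changes + `N(T₂) ≤ N(T₁) + m` ⟹ every zero with
  ordinate in `(T₁, T₂)` is on the line.

[cite: Brent1979, Thm 3.2 and §4]; IVT [folklore].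
-/

noncomputable section

set_option linter.dupNamespace false
set_option autoImplicit false

open Complex Filter Set
open scoped Real Topology
open Literature.NumberTheory.LFunctions

namespace Summit.RiemannHypothesis.RiemannHypothesis.Theorems.SigmaLCert


/-- **Windowed Brent criterion (RH-free).** If `Z` is a finite set of ordinates `γ ∈ (a, b]`
(`0 ≤ a ≤ b`) of zeros of `ζ` on the critical line and `N(b) ≤ N(a) + |Z|`, then EVERY zero of `ζ`
with ordinate in `(a, b]` has real part `½`: the off-line count `N − N₀` is monotone
(`zetaZeroCount_sub_criticalZeroCount_mono`), `N₀(a) + |Z| ≤ N₀(b)` (`criticalZeroCount_add_card_le`)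
forces `N(b) − N₀(b) = N(a) − N₀(a)`, and an off-line zero in the window would make the off-line
multiplicity sum over `(0, b]` strictly exceed the one over `(0, a]`. No information about the zeros
below `a` enters. [cite: Brent1979, §4] -/
theorem onLine_of_located_zeros {a b : ℝ} (ha : 0 ≤ a) (hab : a ≤ b) (Z : Finset ℝ)
    (hZ : ∀ γ ∈ Z, riemannZeta (1 / 2 + γ * I) = 0 ∧ a < γ ∧ γ ≤ b)
    (hN : zetaZeroCount b ≤ zetaZeroCount a + Z.card) {ρ : ℂ} (hζ : riemannZeta ρ = 0)
    (haρ : a < ρ.im) (hρb : ρ.im ≤ b) : ρ.re = 1 / 2 := by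
  have h1 := criticalZeroCount_add_card_le ha hab Z hZ
  have hmono := zetaZeroCount_sub_criticalZeroCount_mono hab
  have heq : (zetaZeroCount b : ℤ) - criticalZeroCount b =
      (zetaZeroCount a : ℤ) - criticalZeroCount a := by
    have e1 : (zetaZeroCount b : ℤ) ≤ zetaZeroCount a + Z.card := by exact_mod_cast hN
    have e2 : (criticalZeroCount a : ℤ) + Z.card ≤ criticalZeroCount b := by exact_mod_cast h1
    linarith
  rw [intCast_zetaZeroCount_sub_criticalZeroCount, intCast_zetaZeroCount_sub_criticalZeroCount]
    at heq
  by_contra hre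
  have hρb' : ρ ∈ zetaZeroBox 0 b \ {ρ ∈ zetaZeroBox (1 / 2) b | ρ.re = 1 / 2} :=
    ⟨Literature.NumberTheory.DiophantineGeometry.mem_zetaZeroBox_of_riemannZeta_eq_zero hζ
      (ha.trans_lt haρ) hρb, fun h ↦ hre h.2⟩
  have hρa' : ρ ∉ zetaZeroBox 0 a \ {ρ ∈ zetaZeroBox (1 / 2) a | ρ.re = 1 / 2} :=
    fun h ↦ absurd h.1.2.2.2.2 (not_le.2 haρ)
  have hsub : zetaZeroBox 0 a \ {ρ ∈ zetaZeroBox (1 / 2) a | ρ.re = 1 / 2} ⊆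
      zetaZeroBox 0 b \ {ρ ∈ zetaZeroBox (1 / 2) b | ρ.re = 1 / 2} := by
    rintro ρ' ⟨⟨h0, h1', h2, h3, h4⟩, hnot⟩
    refine ⟨⟨h0, h1', h2, h3, h4.trans hab⟩, ?_⟩
    rintro ⟨⟨-, h1'', -, -, -⟩, h5⟩
    exact hnot ⟨⟨h0, h1'', h2, h3, h4⟩, h5⟩
  have hB : (zetaZeroBox 0 b \ {ρ ∈ zetaZeroBox (1 / 2) b | ρ.re = 1 / 2}).Finite :=
    (zetaZeroBox_finite 0 b).sdiff
  have hA := hB.subset hsub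
  rw [finsum_mem_eq_finite_toFinset_sum _ hA, finsum_mem_eq_finite_toFinset_sum _ hB] at heq
  have hlt := Finset.sum_lt_sum_of_subset ((Finite.toFinset_subset_toFinset).2 hsub)
    ((Finite.mem_toFinset hB).2 hρb') (fun h ↦ hρa' ((Finite.mem_toFinset hA).1 h))
    (Literature.NumberTheory.DiophantineGeometry.riemannZetaZeroOrder_pos_of_mem_zetaZeroBox hρb'.1)
    (fun j hj _ ↦ (Literature.NumberTheory.DiophantineGeometry.riemannZetaZeroOrder_pos_of_mem_zetaZeroBox
      ((Finite.mem_toFinset hB).1 hj).1).le)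
  exact absurd heq (ne_of_gt hlt)

/-- **Window certificate ⟹ RH in the window.** For `0 ≤ T₁`: a grid `T₁ ≤ s₀ < ⋯ < s_m ≤ T₂` with `m`
strict sign changes of Hardy's `Z` and the count inequality `N(T₂) ≤ N(T₁) + m` force every zero of `ζ`
with ordinate in `(T₁, T₂)` (indeed in `(T₁, T₂]`) onto the critical line. RH-free; nothing here bears
on RH. [cite: Brent1979, Thm 3.2 and §4] -/
theorem onLine_of_window_certificate {T₁ T₂ : ℝ} {m : ℕ} (h0 : 0 ≤ T₁)
    (s : Fin (m + 1) → ℝ) (hs : StrictMono s) (hs0 : T₁ ≤ s 0) (hsm : s (Fin.last m) ≤ T₂)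
    (hsign : ∀ i : Fin m, hardyZ (s i.castSucc) * hardyZ (s i.succ) < 0)
    (hN : zetaZeroCount T₂ ≤ zetaZeroCount T₁ + m) :
    ∀ ρ : ℂ, riemannZeta ρ = 0 → T₁ < ρ.im → ρ.im < T₂ → ρ.re = 1 / 2 := by
  obtain ⟨Z, hcard, hZ⟩ := exists_finset_zeros_of_hardyZ_sign_changes s hs hsign
  have h12 : T₁ ≤ T₂ := hs0.trans ((hs.monotone (Fin.zero_le _)).trans hsm)
  intro ρ hζ h1 h2
  exact onLine_of_located_zeros h0 h12 Z
    (fun γ hγ ↦ ⟨(hZ γ hγ).1, hs0.trans_lt (hZ γ hγ).2.1, ((hZ γ hγ).2.2.le.trans hsm)⟩)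
    (by rw [hcard]; exact hN) hζ h1 h2.le

end Summit.RiemannHypothesis.RiemannHypothesis.Theorems.SigmaLCert

end
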